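import Mathlib.MeasureTheory.Integral.Bochner.Set
import Mathlib.MeasureTheory.Constructions.Pi
import Mathlib.MeasureTheory.Measure.Lebesgue.Basic
import Mathlib.Analysis.SpecialFunctions.Exp
import Mathlib.Analysis.Complex.Basic
import Mathlib.Analysis.SpecialFunctions.Trigonometric.Basic
import Mathlib.RingTheory.Algebraic.Basic
import Mathlib.Algebra.MvPolynomial.Cardinal
import Literature.ModelTheory.ExponentialFields.Semialgebraic
import HarnessLib

-- provenance: harness21/H21/H21/Prelude/TranscendEllArithS/KZPeriods.lean @ 8dffb85 (interim HEAD d8f2665); M5 mechanical rewrite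
/-!
# Kontsevich–Zagier effective periods and exponential periods (trunk T-TRANSCEND / G06, outline C2)

A real number `x` is an *effective period* (Kontsevich–Zagier) if it is the value of an
absolutely convergent integral `∫_σ p/q` of a rational function `p/q`, `p q ∈ ℚ[x₁, …, xₙ]`, over a
`ℚ`-semialgebraic domain `σ ⊆ ℝⁿ` (a set given by polynomial equalities and inequalities with
rational coefficients), with respect to Lebesgue measure. A complex number is a period if its real
and imaginary parts are. The set `P` of periods is a countable subring of `ℂ` containing `ℚ̄`;
`P̂ = P[1/π]` is the ring of *extended periods*. *Exponential periods* (KZ §4.3) allow an extra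
weight `exp (-f)`, `f ∈ ℚ[x₁, …, xₙ]`, in the integrand.

## Main definitions

* `Literature.IsRealPeriod x`, `Literature.IsPeriod z`, `Literature.periods : Set ℂ`.
* `Literature.extendedPeriods : Subring ℂ` — `P̂ = P[1/π]`, the subring generated by `P` and `π⁻¹`.
* `Literature.IsRealExponentialPeriod x`, `Literature.IsExponentialPeriod z`, `Literature.exponentialPeriods : Set ℂ`.

## Main statements (proofs deferred)

* `Literature.NumberTheory.Transcendental.IsPeriod.add`, `Literature.NumberTheory.Transcendental.IsPeriod.mul`, `Literature.NumberTheory.Transcendental.IsPeriod.neg` — `P` is a subring (Fubini and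
  products of semialgebraic domains); packaged as `Literature.NumberTheory.Transcendental.exists_subring_coe_eq_periods`.
* `Literature.NumberTheory.Transcendental.isPeriod_of_isAlgebraic` — `ℚ̄ ⊆ P`.
* `Literature.NumberTheory.Transcendental.periods_countable` — `P` is countable (proved: `periods_countable_holds`).
* `Literature.NumberTheory.Transcendental.IsPeriod.isExponentialPeriod` — every period is an exponential period.

## References

* M. Kontsevich, D. Zagier, *Periods*, in: Mathematics Unlimited — 2001 and Beyond (2001),
  §1.1 (definition, basic properties), §4.3 (exponential periods).
* A. Huber, S. Müller-Stach, *Periods and Nori Motives* (2017), Ch. 12 (equivalent definitions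
  of Kontsevich–Zagier periods).
* J. Commelin, P. Habegger, A. Huber, *Exponential periods and o-minimality* (2020).

## Design notes

* Mathlib (searched: `Kontsevich`, `IsPeriod`, `period`) has no notion of Kontsevich–Zagier
  period (`Function.IsPeriodicPt`, `PeriodPair` are unrelated); we use Mathlib's Bochner integral
  `∫ y in σ, _` against `volume` on `Fin n → ℝ`, `MeasureTheory.IntegrableOn`, `Subring.closure`,
  `Real.pi`, `Real.exp`, `IsAlgebraic`, and H21's `IsSemialgebraic ℚ` (outline C1).
* Conventions. We take *rational* coefficients for `σ`, `p`, `q` (KZ 2001, §1.1) and require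
  `q ≠ 0` on `σ` so that the integrand is a genuine function on `σ` (no `x / 0 = 0` junk values
  enter the definition). Replacing `ℚ` by `ℚ̄ ∩ ℝ` (or `ℤ`), dropping the hypothesis `q ≠ 0 on σ`
  in favour of mere absolute convergence, or integrating algebraic differential forms over
  `ℚ̄`-semialgebraic sets all give the same set of periods; these are *theorems*
  (Huber–Müller-Stach 2017, Ch. 12), not assumptions made here. Likewise the variants of
  exponential periods in Commelin–Habegger–Huber 2020 (algebraic `f`, algebraic forms) agree with
  the rational-data definition below by theorem.
* `periods` is a `Set ℂ`; the ring structure is stated as the theorem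
  `exists_subring_coe_eq_periods` (its proof needs Fubini and `IsSemialgebraic.prod`), keeping the
  definitions `sorry`-free. `extendedPeriods` is directly a `Subring ℂ` via `Subring.closure`.
-/

noncomputable section

open MeasureTheory MvPolynomial Set

namespace Literature.NumberTheory.Transcendental

/-! ### Effective periods -/

/-- A real number `x` is a *(real, effective) Kontsevich–Zagier period* if there are `n : ℕ`, a
`ℚ`-semialgebraic set `σ ⊆ ℝⁿ` and polynomials `p q ∈ ℚ[x₁, …, xₙ]` with `q` non-vanishing on `σ`
such that `p/q` is absolutely integrable on `σ` (Lebesgue measure) and `x = ∫_σ p/q`.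
[Kontsevich–Zagier 2001, §1.1, Definition] [cite: KontsevichZagier2001, §1.1  Definition] -/
def IsRealPeriod (x : ℝ) : Prop :=
  ∃ (n : ℕ) (σ : Set (Fin n → ℝ)) (p q : MvPolynomial (Fin n) ℚ),
    Literature.ModelTheory.ExponentialFields.IsSemialgebraic ℚ σ ∧ (∀ y ∈ σ, aeval y q ≠ 0) ∧
      IntegrableOn (fun y => aeval y p / aeval y q) σ ∧
        x = ∫ y in σ, aeval y p / aeval y q

/-- A complex number `z` is a *(effective) Kontsevich–Zagier period* if both its real part and its
imaginary part are real periods. [Kontsevich–Zagier 2001, §1.1, Definition] [cite: KontsevichZagier2001, §1.1  Definition] -/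
def IsPeriod (z : ℂ) : Prop :=
  IsRealPeriod z.re ∧ IsRealPeriod z.im

/-- The set `P ⊆ ℂ` of (effective) Kontsevich–Zagier periods.
[Kontsevich–Zagier 2001, §1.1] [cite: KontsevichZagier2001, §1.1] -/
def periods : Set ℂ :=
  {z | IsPeriod z}

/-- The ring `P̂ = P[1/π]` of *extended periods*: the subring of `ℂ` generated by the periods and
`π⁻¹`. [Kontsevich–Zagier 2001, §1.1] [cite: KontsevichZagier2001, §1.1] -/
def extendedPeriods : Subring ℂ :=
  Subring.closure (insert ((Real.pi : ℂ)⁻¹) periods)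

/-- Membership in `periods` is `IsPeriod`. [Kontsevich–Zagier 2001, §1.1] [cite: KontsevichZagier2001, §1.1] -/
@[simp] theorem mem_periods_iff {z : ℂ} : z ∈ periods ↔ IsPeriod z := Iff.rfl

/-! ### Exponential periods -/

/-- A real number `x` is a *(real) exponential period* if there are `n : ℕ`, a `ℚ`-semialgebraic
set `σ ⊆ ℝⁿ` and polynomials `f p q ∈ ℚ[x₁, …, xₙ]` with `q` non-vanishing on `σ` such that
`exp (-f) · p/q` is absolutely integrable on `σ` and `x = ∫_σ exp (-f) · p/q`.
[Kontsevich–Zagier 2001, §4.3; Commelin–Habegger–Huber 2020, Def. 1.1 (equivalent variants)] [cite: KontsevichZagier2001, §4.3] -/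
def IsRealExponentialPeriod (x : ℝ) : Prop :=
  ∃ (n : ℕ) (σ : Set (Fin n → ℝ)) (f p q : MvPolynomial (Fin n) ℚ),
    Literature.ModelTheory.ExponentialFields.IsSemialgebraic ℚ σ ∧ (∀ y ∈ σ, aeval y q ≠ 0) ∧
      IntegrableOn (fun y => Real.exp (-(aeval y f)) * aeval y p / aeval y q) σ ∧
        x = ∫ y in σ, Real.exp (-(aeval y f)) * aeval y p / aeval y q

/-- A complex number `z` is an *exponential period* if both its real part and its imaginary part
are real exponential periods. [Kontsevich–Zagier 2001, §4.3] [cite: KontsevichZagier2001, §4.3] -/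
def IsExponentialPeriod (z : ℂ) : Prop :=
  IsRealExponentialPeriod z.re ∧ IsRealExponentialPeriod z.im

/-- The set of exponential periods in `ℂ`. [Kontsevich–Zagier 2001, §4.3] [cite: KontsevichZagier2001, §4.3] -/
def exponentialPeriods : Set ℂ :=
  {z | IsExponentialPeriod z}

/-- Membership in `exponentialPeriods` is `IsExponentialPeriod`. [Kontsevich–Zagier 2001, §4.3] [cite: KontsevichZagier2001, §4.3] -/
@[simp] theorem mem_exponentialPeriods_iff {z : ℂ} :
    z ∈ exponentialPeriods ↔ IsExponentialPeriod z := Iff.rfl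

/-! ### Ring structure of real periods -/

namespace IsRealPeriod

/-- `0` is a real period (integrate `0` over `ℝ⁰`). [Kontsevich–Zagier 2001, §1.1] [cite: KontsevichZagier2001, §1.1] -/
theorem zero : IsRealPeriod 0 := by
  refine ⟨0, univ, 0, 1, Literature.ModelTheory.ExponentialFields.isSemialgebraic_univ, fun y _ => by simp, ?_, by simp⟩
  simp only [map_zero, zero_div]
  exact integrableOn_zero

/-- Real periods are closed under addition (disjoint union of domains in `ℝ^{max m n + 1}`).
[Kontsevich–Zagier 2001, §1.1] [cite: KontsevichZagier2001, §1.1] -/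
def add : Prop :=
  ∀ {x y : ℝ} (hx : IsRealPeriod x) (hy : IsRealPeriod y),
    IsRealPeriod (x + y)

/-- Real periods are closed under negation (replace `p` by `-p`).
[Kontsevich–Zagier 2001, §1.1] [cite: KontsevichZagier2001, §1.1] -/
theorem neg {x : ℝ} (hx : IsRealPeriod x) : IsRealPeriod (-x) := by
  obtain ⟨n, σ, p, q, hσ, hq, hint, rfl⟩ := hx
  refine ⟨n, σ, -p, q, hσ, hq, ?_, ?_⟩
  · simpa [neg_div] using hint.neg
  · simp [neg_div, integral_neg]

/-- Real periods are closed under subtraction. [Kontsevich–Zagier 2001, §1.1] [cite: KontsevichZagier2001, §1.1] -/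
def sub : Prop :=
  ∀ {x y : ℝ} (hx : IsRealPeriod x) (hy : IsRealPeriod y),
    IsRealPeriod (x - y)

/- interim proof relied on results that are now named facts (D-0014); demoted to a fact by the M5 import, proof preserved:
:= by
  simpa [sub_eq_add_neg] using hx.add hy.neg
-/

/-- Real periods are closed under multiplication (product of domains and Fubini).
[Kontsevich–Zagier 2001, §1.1] [cite: KontsevichZagier2001, §1.1] -/
def mul : Prop :=
  ∀ {x y : ℝ} (hx : IsRealPeriod x) (hy : IsRealPeriod y),
    IsRealPeriod (x * y)

end IsRealPeriod

/-- Every rational number is a real period (`r = ∫_{[0,1]} r`). [Kontsevich–Zagier 2001, §1.1] [cite: KontsevichZagier2001, §1.1] -/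
def isRealPeriod_ratCast : Prop :=
  ∀ (r : ℚ),
    IsRealPeriod (r : ℝ)

/-- `π = ∫∫_{x² + y² ≤ 1} 1` is a real period. [Kontsevich–Zagier 2001, §1.1] [cite: KontsevichZagier2001, §1.1] -/
def isRealPeriod_pi : Prop :=
  IsRealPeriod Real.pi

/-- Every real algebraic number is a real period. [Kontsevich–Zagier 2001, §1.1] [cite: KontsevichZagier2001, §1.1] -/
def isRealPeriod_of_isAlgebraic : Prop :=
  ∀ {x : ℝ} (hx : IsAlgebraic ℚ x),
    IsRealPeriod x

/-! ### Ring structure of complex periods -/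

namespace IsPeriod

/-- `0` is a period. [Kontsevich–Zagier 2001, §1.1] [cite: KontsevichZagier2001, §1.1] -/
theorem zero : IsPeriod 0 :=
  ⟨by simpa using IsRealPeriod.zero, by simpa using IsRealPeriod.zero⟩

/-- Periods are closed under addition. [Kontsevich–Zagier 2001, §1.1] [cite: KontsevichZagier2001, §1.1] -/
def add : Prop :=
  ∀ {z w : ℂ} (hz : IsPeriod z) (hw : IsPeriod w),
    IsPeriod (z + w)

/- interim proof relied on results that are now named facts (D-0014); demoted to a fact by the M5 import, proof preserved:
:=
  ⟨by simpa using hz.1.add hw.1, by simpa using hz.2.add hw.2⟩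
-/

/-- Periods are closed under negation. [Kontsevich–Zagier 2001, §1.1] [cite: KontsevichZagier2001, §1.1] -/
theorem neg {z : ℂ} (hz : IsPeriod z) : IsPeriod (-z) :=
  ⟨by simpa using hz.1.neg, by simpa using hz.2.neg⟩

/-- Periods are closed under multiplication:
`(z w).re = z.re w.re - z.im w.im`, `(z w).im = z.re w.im + z.im w.re`.
[Kontsevich–Zagier 2001, §1.1] [cite: KontsevichZagier2001, §1.1] -/
def mul : Prop :=
  ∀ {z w : ℂ} (hz : IsPeriod z) (hw : IsPeriod w),
    IsPeriod (z * w)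

/- interim proof relied on results that are now named facts (D-0014); demoted to a fact by the M5 import, proof preserved:
:=
  ⟨by simpa [Complex.mul_re] using (hz.1.mul hw.1).sub (hz.2.mul hw.2),
    by simpa [Complex.mul_im] using (hz.1.mul hw.2).add (hz.2.mul hw.1)⟩
-/

/-- Periods are closed under complex conjugation. [Kontsevich–Zagier 2001, §1.1] [cite: KontsevichZagier2001, §1.1] -/
theorem conj {z : ℂ} (hz : IsPeriod z) : IsPeriod (starRingEnd ℂ z) :=
  ⟨by simpa using hz.1, by simpa using hz.2.neg⟩

/-- A real number, viewed in `ℂ`, is a period iff it is a real period.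
[Kontsevich–Zagier 2001, §1.1] [cite: KontsevichZagier2001, §1.1] -/
theorem _root_.Literature.NumberTheory.Transcendental.isPeriod_ofReal_iff {x : ℝ} : IsPeriod (x : ℂ) ↔ IsRealPeriod x :=
  ⟨fun h => by simpa using h.1, fun h => ⟨by simpa using h, by simpa using IsRealPeriod.zero⟩⟩

/-- A complex number with vanishing imaginary part is a period iff its real part is a real
period. [Kontsevich–Zagier 2001, §1.1] [cite: KontsevichZagier2001, §1.1] -/
theorem _root_.Literature.NumberTheory.Transcendental.isRealPeriod_iff_re {z : ℂ} (hz : z.im = 0) : IsRealPeriod z.re ↔ IsPeriod z :=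
  ⟨fun h => ⟨h, by simpa [hz] using IsRealPeriod.zero⟩, fun h => h.1⟩

/-- Every period is an exponential period (take `f = 0`). [Kontsevich–Zagier 2001, §4.3] [cite: KontsevichZagier2001, §4.3] -/
theorem isExponentialPeriod {z : ℂ} (hz : IsPeriod z) : IsExponentialPeriod z := by
  have key : ∀ x, IsRealPeriod x → IsRealExponentialPeriod x := by
    rintro x ⟨n, σ, p, q, hσ, hq, hint, rfl⟩
    refine ⟨n, σ, 0, p, q, hσ, hq, ?_, ?_⟩
    · simpa using hint
    · simp
  exact ⟨key _ hz.1, key _ hz.2⟩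

end IsPeriod

/-- Every rational number is a period. [Kontsevich–Zagier 2001, §1.1] [cite: KontsevichZagier2001, §1.1] -/
def isPeriod_ratCast : Prop :=
  ∀ (r : ℚ),
    IsPeriod (r : ℂ)

/- interim proof relied on results that are now named facts (D-0014); demoted to a fact by the M5 import, proof preserved:
:= by
  rw [← Complex.ofReal_ratCast, isPeriod_ofReal_iff]
  exact isRealPeriod_ratCast r
-/

/-- `1` is a period. [Kontsevich–Zagier 2001, §1.1] [cite: KontsevichZagier2001, §1.1] -/
def IsPeriod.one : Prop :=
  IsPeriod 1

/- interim proof relied on results that are now named facts (D-0014); demoted to a fact by the M5 import, proof preserved: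
:= by
  simpa using isPeriod_ratCast 1
-/

/-- `π` is a period. [Kontsevich–Zagier 2001, §1.1] [cite: KontsevichZagier2001, §1.1] -/
def KZPeriods.isPeriod_pi : Prop :=
  IsPeriod (Real.pi : ℂ)

/- interim proof relied on results that are now named facts (D-0014); demoted to a fact by the M5 import, proof preserved:
:=
  isPeriod_ofReal_iff.2 isRealPeriod_pi
-/

/-- `ℚ̄ ⊆ P`: every complex number algebraic over `ℚ` is a period (its real and imaginary parts
are real algebraic numbers, hence real periods). [Kontsevich–Zagier 2001, §1.1] [cite: KontsevichZagier2001, §1.1] -/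
def isPeriod_of_isAlgebraic : Prop :=
  ∀ (z : ℂ) (hz : IsAlgebraic ℚ z),
    IsPeriod z

/-- The periods form a subring of `ℂ`. [Kontsevich–Zagier 2001, §1.1] [cite: KontsevichZagier2001, §1.1] -/
def exists_subring_coe_eq_periods : Prop :=
  ∃ P : Subring ℂ, (P : Set ℂ) = periods

/- interim proof relied on results that are now named facts (D-0014); demoted to a fact by the M5 import, proof preserved:
:=
  ⟨{ carrier := periods
     mul_mem' := fun ha hb => ha.mul hb
     one_mem' := IsPeriod.one
     add_mem' := fun ha hb => ha.add hb
     zero_mem' := IsPeriod.zero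
     neg_mem' := fun ha => ha.neg }, rfl⟩
-/

/-- `P` is countable: there are countably many tuples `(n, σ, p, q)` of a `ℚ`-semialgebraic set
and rational polynomials. [Kontsevich–Zagier 2001, §1.1] [cite: KontsevichZagier2001, §1.1] -/
def periods_countable : Prop :=
  periods.Countable

/-- `P ⊆ P̂`. [Kontsevich–Zagier 2001, §1.1] [cite: KontsevichZagier2001, §1.1] -/
theorem periods_subset_extendedPeriods : periods ⊆ (extendedPeriods : Set ℂ) :=
  (subset_insert _ _).trans Subring.subset_closure

/-- `π⁻¹ ∈ P̂`. [Kontsevich–Zagier 2001, §1.1] [cite: KontsevichZagier2001, §1.1] -/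
theorem inv_pi_mem_extendedPeriods : ((Real.pi : ℂ)⁻¹) ∈ extendedPeriods :=
  Subring.subset_closure (mem_insert _ _)

/-- Every period is an exponential period: `P ⊆` exponential periods.
[Kontsevich–Zagier 2001, §4.3] [cite: KontsevichZagier2001, §4.3] -/
theorem periods_subset_exponentialPeriods : periods ⊆ exponentialPeriods :=
  fun _ hz => IsPeriod.isExponentialPeriod hz

end Literature.NumberTheory.Transcendental

/-! ### Countability of `P` (discharge of `periods_countable`)

Kontsevich–Zagier (2001, §1.1, right after the Definition): "We will denote the set of periods by
`P`. It is obviously countable." The obvious proof: a real period is determined by the data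
`(n, σ, p, q)`; for fixed `n` the `ℚ`-semialgebraic `σ ⊆ ℝⁿ` form the Boolean subalgebra generated
by the zero sets and positivity sets of the countably many `p ∈ ℚ[x₁, …, xₙ]`, hence a countable
family; and `P` embeds into (real periods)² via `z ↦ (re z, im z)`. -/

namespace Literature.NumberTheory.Transcendental

section Countable

/-- The Boolean subalgebra generated by a countable subset `s` of a Boolean algebra is countable:
it is exhausted by the finite iterates of the one-step closure
`t ↦ t ∪ {a ⊔ b | a, b ∈ t} ∪ {aᶜ | a ∈ t}` starting from `insert ⊥ s`, each of which is
countable. [folklore] -/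
theorem countable_booleanSubalgebraClosure {α : Type*} [BooleanAlgebra α] {s : Set α}
    (hs : s.Countable) : (BooleanSubalgebra.closure s : Set α).Countable := by
  let step : Set α → Set α := fun t => t ∪ image2 (· ⊔ ·) t t ∪ compl '' t
  let T : ℕ → Set α := fun n => step^[n] (insert ⊥ s)
  have hT_succ : ∀ n, T (n + 1) = step (T n) := fun n => Function.iterate_succ_apply' step n _
  have hTmono : Monotone T := monotone_nat_of_le_succ fun n => by
    rw [hT_succ]; exact subset_union_left.trans subset_union_left
  have hTc : ∀ n, (T n).Countable := fun n => by
    induction n with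
    | zero => exact hs.insert ⊥
    | succ n ih => rw [hT_succ]; exact (ih.union (ih.image2 ih _)).union (ih.image _)
  refine (countable_iUnion hTc).mono fun x hx => ?_
  induction hx using BooleanSubalgebra.closure_bot_sup_induction with
  | mem x hx => exact mem_iUnion.2 ⟨0, mem_insert_of_mem _ hx⟩
  | bot => exact mem_iUnion.2 ⟨0, mem_insert _ _⟩
  | sup x _ y _ hx hy =>
    obtain ⟨i, hi⟩ := mem_iUnion.1 hx
    obtain ⟨j, hj⟩ := mem_iUnion.1 hy
    refine mem_iUnion.2 ⟨max i j + 1, ?_⟩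
    rw [hT_succ]
    exact Or.inl (Or.inr ⟨x, hTmono (le_max_left i j) hi, y, hTmono (le_max_right i j) hj, rfl⟩)
  | compl x _ hx =>
    obtain ⟨i, hi⟩ := mem_iUnion.1 hx
    exact mem_iUnion.2 ⟨i + 1, by rw [hT_succ]; exact Or.inr ⟨x, hi, rfl⟩⟩

/-- Polynomials in countably many variables over a countable commutative semiring form a countable
type (`MvPolynomial.cardinalMk_le_max_lift`). [folklore] -/
theorem countable_mvPolynomial {σ R : Type*} [CommSemiring R] [Countable σ] [Countable R] :
    Countable (MvPolynomial σ R) := by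
  rw [← Cardinal.mk_le_aleph0_iff]
  refine MvPolynomial.cardinalMk_le_max_lift.trans (sup_le (sup_le ?_ ?_) le_rfl) <;>
    exact Cardinal.lift_le_aleph0.2 Cardinal.mk_le_aleph0

/-- Over a countable coefficient ring `k` and countably many variables there are countably many
`k`-semialgebraic subsets of `ι → R`: the generating zero sets `{x | p(x) = 0}` and positivity sets
`{x | 0 < p(x)}` are indexed by the countable type `MvPolynomial ι k`
(`countable_booleanSubalgebraClosure`). The case `k = ℚ`, `R = ℝ`, `ι = Fin n` counts the domains
of integration in the definition of a period. [Kontsevich–Zagier 2001, §1.1] [folklore] -/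
theorem countable_setOf_isSemialgebraic (k : Type*) {R : Type*} (ι : Type*) [CommRing k]
    [CommRing R] [LT R] [Algebra k R] [Countable k] [Countable ι] :
    {s : Set (ι → R) | Literature.ModelTheory.ExponentialFields.IsSemialgebraic k s}.Countable := by
  have : Countable (MvPolynomial ι k) := countable_mvPolynomial
  exact countable_booleanSubalgebraClosure ((countable_range _).union (countable_range _))

/-- The set of real Kontsevich–Zagier periods is countable: every real period is the value of the
integral attached to some datum `(n, σ, p, q)`, `σ ⊆ ℝⁿ` `ℚ`-semialgebraic, `p q ∈ ℚ[x₁, …, xₙ]`,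
and there are countably many such data (`countable_setOf_isSemialgebraic`,
`countable_mvPolynomial`). [Kontsevich–Zagier 2001, §1.1] [cite: KontsevichZagier2001, §1.1] -/
theorem countable_setOf_isRealPeriod : {x : ℝ | IsRealPeriod x}.Countable := by
  have hP : ∀ n : ℕ, Countable (MvPolynomial (Fin n) ℚ) := fun n => countable_mvPolynomial
  have hc : (⋃ n : ℕ, (fun t : Set (Fin n → ℝ) × MvPolynomial (Fin n) ℚ × MvPolynomial (Fin n) ℚ =>
      ∫ y in t.1, aeval y t.2.1 / aeval y t.2.2) ''
        ({σ | Literature.ModelTheory.ExponentialFields.IsSemialgebraic ℚ σ} ×ˢ univ)).Countable :=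
    countable_iUnion fun n =>
      ((countable_setOf_isSemialgebraic ℚ (Fin n)).prod (to_countable _)).image _
  refine hc.mono ?_
  rintro x ⟨n, σ, p, q, hσ, -, -, rfl⟩
  exact mem_iUnion.2 ⟨n, (σ, p, q), ⟨hσ, mem_univ _⟩, rfl⟩

/-- **The set `P` of Kontsevich–Zagier periods is countable** — discharge of the named fact
`Literature.NumberTheory.Transcendental.periods_countable`: `P` is the preimage of
(real periods) × (real periods) under the injection `z ↦ (re z, im z)` (`Complex.equivRealProd`),
and the set of real periods is countable (`countable_setOf_isRealPeriod`).
[Kontsevich–Zagier 2001, §1.1: "We will denote the set of periods by `P`. It is obviously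
countable."] [cite: KontsevichZagier2001, §1.1] -/
theorem periods_countable_holds : periods_countable := by
  unfold periods_countable
  refine ((countable_setOf_isRealPeriod.prod countable_setOf_isRealPeriod).preimage
    Complex.equivRealProd.injective).mono fun z hz => ?_
  exact mk_mem_prod hz.1 hz.2

end Countable

end Literature.NumberTheory.Transcendental
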